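import Literature.Barriers.CriticalPhenomena.PlaquetteWalkHoleRootPrefixLoopChains
import Literature.Barriers.CriticalPhenomena.PlaquetteWalkHoleRootRootNotchEast
import HarnessLib

/-!
# Barrier catalogue (SAWScalingLimit): THE ORDER LAW ON THE EASTERN RAY WITH PARITY — a wound under-walk needs TWO live
ray columns, its prefix in the western one; the eastern pocket on the wall EMPTIES the under route

Leaf of `PlaquetteWalkHoleRootPrefixLoopChains` (§5: the order law on the eastern ray — an excursion crossing of the bottom
line of the root row at column `x' ≥ w.1` forces a PREFIX crossing at some column `w.1 ≤ x < x'`) and of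
`PlaquetteWalkHoleRootRootNotchEast` (the one-route tools). Setting: root plaquette `w` rooted at `W`, hole
`holeFaceW w = (w.1 − 1, w.2) ∉ D`, far cell `farW w`; the EASTERN RAY of the hole = the bottom sides `slant x w.2`, `x ≥ w.1`,
of the root row (`rayMid (holeFaceW w) E m = slant (w.1 + m) w.2`); a ray column `x` is LIVE when both its faces `(x, w.2)`
and `(x, w.2 − 1)` lie in `D` (only live ray edges are mid-edges of walks).

§1 ★★★★★ `ΩG.exists_prefix_lt_exit_ray_of_AJ_ne_zero` — **THE TWO-COLUMN LAW**: hole absent, `ω` a class-`B2a` UNDER-walk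
whose excursion polygon winds around the root. Then there are ray columns `w.1 + m < w.1 + m'` such that the PREFIX crosses
`slant (w.1 + m) w.2` and a slot of the excursion polygon exits through `slant (w.1 + m') w.2`; both columns are live
(`ΩG.live_of_prefix_nth_eq_slant`, `ΩG.live_of_exit_eq_slant`). Proof: the winding parity law
(`AJ_root_ne_zero_iff_odd_rayCountAt` behind the hole's `E` side) gives an excursion crossing; the order law gives the prefix
crossing west of it.
§2 ★★★★★ `ΩG.AJ_root_eq_zero_of_under_ray_pairwise` / `ΩG.WE_eq_excursionWinding_of_under_ray_pairwise` — **NO TWO LIVE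
RAY COLUMNS `w.1 ≤ x < x'` ⇒ NO WOUND UNDER-WALK** (either orientation of the winding witness), every domain. This contains
`RootNotchEast` §1 and `RootNotchLiveColumn` §2 (there `rootS ∉ D` kills column `w.1`, and at most one further column is
live) and is NEW when `rootS` is present: ★★★★★ `ΩG.WE_eq_excursionWinding_of_under_eastShut` — the ray shut from column
`w.1 + 1` on (`(x, w.2) ∉ D ∨ (x, w.2 − 1) ∉ D` for every `x ≥ w.1 + 1`) ⇒ no wound under-walk, WHATEVER `rootS`. The
row-mirror twins (`…_of_over_rayN_pairwise`, `…_of_over_eastShutN`: top line of the root row, over-walks) by `ΩG.mirrorFar`.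
The tree's `PlaquetteWalkHoleRootEastWall` §2/§4 knew this geometry only as a `w₁`-KILL («every wound walk crosses `w.S`
and doubles `w`»): for the under route the truth is emptiness — the lower-corner law of the parent (`ΩG.exit_ne_root_S_of_under`)
forbids the crossing of `w.S` outright.
§3 Boxes (the lane's `lawL_box_…` vocabulary, any further defects `S ∋ h` missing the far cell): ★★★★★
`lawL_box_eastPocketSE_not_wound_under` — the hole two columns from the east wall (`h.1 + 3 = m`) and the eastern pocket
`(h.1 + 2, h.2 − 1)` removed ⇒ NO WOUND UNDER-WALK (the lane's LAW L table had «`VF(2π/3) = 0`, a `w₁`-kill» for this cell;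
kit j283492/j300087 never found an under witness there); twin `lawL_box_eastPocketNE_not_wound_over`; and the vanishing
under-route mass `lawL_box_eastPocketSE_sum_routeMassW_S_eq_zero`.

Not in print (the printed sources root walks on the outer boundary); venture lane «pcv-sawmu», seat b-step0 gen 29
(FINDING-YB-KILL-FORCED-ZEROS §28).

References: R. Courant, H. Robbins, *What is Mathematics?* (1941/1958), Ch. V Appendix §2 (the even–odd rule, the order
of a point) [CourantRobbins1958]; L. V. Ahlfors, *Complex Analysis*, 3rd ed. (1979), Ch. 4 §2.1 [AhlforsCA1979];
A. Glazman, Electron. Commun. Probab. 20 (2015) no. 86, Lemma 3.1, proof pp. 6–7 [Glazman2015WeightedSAW]; A. Glazman,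
I. Manolescu, arXiv:1708.00395v3, §1 (Fig. 1, Fig. 2), §2.1, §4.2 (lattice symmetries), Lemma 2.1 [GlazmanManolescu2019].
-/

noncomputable section

open Set Function Complex
open Literature.Topology.PlaneTopology

namespace Literature.Probability.RandomPlanarGeometry.SAW.YangBaxter

open Real
open Literature.Barriers.CriticalPhenomena.PlaquetteWalk (mirrorRowFace)

open private len_eq side_jOut from Literature.Probability.RandomPlanarGeometry.YangBaxterSAWExcursionJordan

namespace ΩG

variable {D : Set Face} {w : Face} {ω : ΩG D (w.side .W) (farW w)}

/-! ## §1 The two-column law -/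

/-- **A prefix mid-edge on the eastern ray is a live ray edge**: both faces of `slant x w.2` lie in `D`.
[cite: Glazman2015WeightedSAW, Lemma 3.1 (proof, pp. 6–7: the classes of walks through a rhombus)] -/
theorem live_of_prefix_nth_eq_slant (h : ω.IsB2a) {i : ℕ} (hi1 : 1 ≤ i) (hiF : i ≤ ω.2.firstHitG) {x y : ℤ}
    (e : ω.2.nth i = MidEdge.slant x y) : ((x, y) : Face) ∈ D ∧ ((x, y - 1) : Face) ∈ D := by
  have hF := ω.fh_lt h
  have hd := ω.2.door_nth (j := i) (by omega) (by omega)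
  rw [e] at hd
  simp only [MidEdge.faces] at hd
  exact ⟨hd.2, hd.1⟩

/-- **An exit mid-edge of a slot on the eastern ray is a live ray edge** (hole absent: the last mid-edge of the walk is a
side of the far cell, never on the eastern ray, so every such exit mid-edge is a door).
[cite: Glazman2015WeightedSAW, Lemma 3.1 (proof, pp. 6–7: the classes of walks through a rhombus)] -/
theorem live_of_exit_eq_slant (hr : RootedFace D (w.side .W) (farW w)) (h : ω.IsB2a) {j : ℕ} (hj : j < ω.Mv) {m : ℕ}
    (e : (ω.jFace h j).side (ω.jOut hr h j) = MidEdge.slant (w.1 + m) w.2) :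
    ((w.1 + m, w.2) : Face) ∈ D ∧ ((w.1 + m, w.2 - 1) : Face) ∈ D := by
  have hF := ω.fh_lt h
  have hlen : ω.2.arcs.length = ω.2.firstHitG + ω.Mv := len_eq h
  rw [side_jOut (hr := hr) h hj] at e
  have hlt : ω.2.firstHitG + j + 1 < ω.2.arcs.length := by
    rcases Nat.lt_or_ge (ω.2.firstHitG + j + 1) ω.2.arcs.length with hl | hl
    · exact hl
    · exfalso
      have heq : ω.2.firstHitG + j + 1 = ω.2.arcs.length := by omega
      rw [heq, ω.2.nth_length] at e
      exact farW_side_ne_slant_east w ω.1 m e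
  have hd := ω.2.door_nth (j := ω.2.firstHitG + j + 1) (by omega) hlt
  rw [e] at hd
  simp only [MidEdge.faces] at hd
  exact ⟨hd.2, hd.1⟩

/-- ★★★★★ **THE TWO-COLUMN LAW.** Hole absent; `ω` a class-`B2a` UNDER-walk at the far cell (first side `S`) whose excursion
polygon winds around the root (`AJ ≠ 0`). Then for some `m < m'` the PREFIX crosses the ray edge `slant (w.1 + m) w.2`
(`nth i`, `1 ≤ i ≤ F`) and a slot of the excursion polygon exits through `slant (w.1 + m') w.2` — two distinct live columns of
the eastern ray, the prefix's strictly west of the excursion's. (Parity: `AJ_root_ne_zero_iff_odd_rayCountAt` behind the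
hole's `E` side gives the excursion crossing; the parent's order law gives the prefix crossing.)
[cite: CourantRobbins1958, Ch. V Appendix §2 (The Jordan Curve Theorem for Polygons: the even–odd rule)]
[cite: AhlforsCA1979, Ch. 4 §2.1 (index of a point with respect to a closed curve)]
[cite: Glazman2015WeightedSAW, Lemma 3.1 (proof, pp. 6–7: the classes of walks through a rhombus)] -/
theorem exists_prefix_lt_exit_ray_of_AJ_ne_zero (hh : holeFaceW w ∉ D) (ω : ΩG D (w.side .W) (farW w))
    (hr : RootedFace D (w.side .W) (farW w)) (h : ω.IsB2a) (hS : ω.2.firstSideG = .S)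
    (hA : ω.AJ hr h (toC (midPt (w.side .W))) ≠ 0) :
    ∃ m m' : ℕ, m < m' ∧ (∃ i, 1 ≤ i ∧ i ≤ ω.2.firstHitG ∧ ω.2.nth i = MidEdge.slant (w.1 + m) w.2) ∧
      ∃ j, j < ω.Mv ∧ (ω.jFace h j).side (ω.jOut hr h j) = MidEdge.slant (w.1 + m') w.2 := by
  classical
  have hodd := (ω.AJ_root_ne_zero_iff_odd_rayCountAt (hr := hr) h (b := holeFaceW w) (τ := .E)
    (holeFaceW_side_E w)).1 hA
  have hpos := hodd.pos
  unfold ΩG.rayCountAt at hpos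
  obtain ⟨j, hj⟩ := Finset.card_pos.1 hpos
  rw [Finset.mem_filter, Finset.mem_range] at hj
  obtain ⟨hj, m', hm'⟩ := hj
  rw [rayMid_holeFaceW_E_eq] at hm'
  obtain ⟨x, i, hxw, hxx, hi1, hiF, e⟩ :=
    exists_prefix_nth_eq_slant_lt_of_exit hh hr h hS (x' := w.1 + m') (by omega) ⟨j, hj, hm'⟩
  refine ⟨(x - w.1).toNat, m', by omega, ⟨i, hi1, hiF, ?_⟩, j, hj, hm'⟩
  rw [e]; congr 1; omega

/-! ## §2 No two live ray columns ⇒ no wound under-walk; the ray shut east of the root plaquette -/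

/-- ★★★★★ **NO TWO LIVE RAY COLUMNS ⇒ THE EXCURSION OF AN UNDER-WALK DOES NOT WIND AROUND THE ROOT.** Hole absent; for all
ray columns `w.1 ≤ x < x'` one of the two is dead (`(x, w.2) ∉ D ∨ (x, w.2 − 1) ∉ D`, or the same for `x'`). Then
`AJ = 0` for every class-`B2a` under-walk at the far cell.
[cite: CourantRobbins1958, Ch. V Appendix §2 (the even–odd rule)] [cite: AhlforsCA1979, Ch. 4 §2.1 (index of a point)]
[cite: Glazman2015WeightedSAW, Lemma 3.1 (proof, pp. 6–7)] -/
theorem AJ_root_eq_zero_of_under_ray_pairwise (hh : holeFaceW w ∉ D)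
    (hray : ∀ x x' : ℤ, w.1 ≤ x → x < x' →
      ((x, w.2) ∉ D ∨ (x, w.2 - 1) ∉ D) ∨ ((x', w.2) ∉ D ∨ (x', w.2 - 1) ∉ D))
    (ω : ΩG D (w.side .W) (farW w)) (hr : RootedFace D (w.side .W) (farW w)) (h : ω.IsB2a)
    (hS : ω.2.firstSideG = .S) : ω.AJ hr h (toC (midPt (w.side .W))) = 0 := by
  by_contra hA
  obtain ⟨m, m', hmm, ⟨i, hi1, hiF, e⟩, j, hj, e'⟩ := exists_prefix_lt_exit_ray_of_AJ_ne_zero hh ω hr h hS hA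
  have h1 := live_of_prefix_nth_eq_slant h hi1 hiF e
  have h2 := live_of_exit_eq_slant hr h hj e'
  rcases hray (w.1 + m) (w.1 + m') (by omega) (by omega) with (hx | hx) | (hx | hx)
  · exact hx h1.1
  · exact hx h1.2
  · exact hx h2.1
  · exact hx h2.2

/-- ★★★★★ **NO TWO LIVE RAY COLUMNS ⇒ NO WOUND UNDER-WALK** (either orientation of the winding witness): under the hypotheses
of `AJ_root_eq_zero_of_under_ray_pairwise`, every class-`B2a` under-walk at the far cell has its Yang–Baxter winding equal to
the excursion winding. Contains `ΩG.WE_eq_excursionWinding_of_under_rootS_east` and `…_of_under_rootS_oneLiveColumn`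
(`rootS ∉ D` kills column `w.1`).
[cite: GlazmanManolescu2019, Lemma 2.1 (statement, "in the form given in [Gl]"), §1 (Fig. 2)]
[cite: Glazman2015WeightedSAW, Lemma 3.1 (proof, pp. 6–7)] [cite: CourantRobbins1958, Ch. V Appendix §2 (the even–odd rule)] -/
theorem WE_eq_excursionWinding_of_under_ray_pairwise (hh : holeFaceW w ∉ D)
    (hray : ∀ x x' : ℤ, w.1 ≤ x → x < x' →
      ((x, w.2) ∉ D ∨ (x, w.2 - 1) ∉ D) ∨ ((x', w.2) ∉ D ∨ (x', w.2 - 1) ∉ D))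
    (ω : ΩG D (w.side .W) (farW w)) (hr : RootedFace D (w.side .W) (farW w)) (h : ω.IsB2a)
    (hS : ω.2.firstSideG = .S) (θ : ℝ) :
    ω.WE (fun _ => θ) = excursionWinding θ ω.2.firstSideG (ω.z1 hr h) ω.1 := by
  by_contra hW
  rcases ω.AJ_ne_zero_or_rev_of_wound hr h θ hW with hA | hA
  · exact hA (AJ_root_eq_zero_of_under_ray_pairwise hh hray ω hr h hS)
  · have h' := ω.rev_isB2a hr h
    have hS' : (ω.rev hr).2.firstSideG = .S := by rw [ω.rev_firstSide hr h]; exact hS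
    exact hA (AJ_root_eq_zero_of_under_ray_pairwise hh hray (ω.rev hr) hr h' hS')

/-- ★★★★★ **THE RAY SHUT EAST OF THE ROOT PLAQUETTE ⇒ NO WOUND UNDER-WALK, WHATEVER `rootS`.** Hole absent and every ray
column `x ≥ w.1 + 1` dead (`(x, w.2) ∉ D ∨ (x, w.2 − 1) ∉ D`) — e.g. `rootE` or `pocketSE` absent with the wall beyond. Then
no class-`B2a` under-walk at the far cell is wound: the only live ray column is `w.1` itself, whose edge `w.S` the excursion of
an under-walk never crosses (lower-corner law). (`PlaquetteWalkHoleRootEastWall` §2 typed this geometry as a `w₁`-kill only.)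
[cite: GlazmanManolescu2019, Lemma 2.1 (statement, "in the form given in [Gl]"), §1 (Fig. 2)]
[cite: Glazman2015WeightedSAW, Lemma 3.1 (proof, pp. 6–7)] [cite: CourantRobbins1958, Ch. V Appendix §2 (the even–odd rule)] -/
theorem WE_eq_excursionWinding_of_under_eastShut (hh : holeFaceW w ∉ D)
    (hray : ∀ x : ℤ, w.1 + 1 ≤ x → (x, w.2) ∉ D ∨ (x, w.2 - 1) ∉ D)
    (ω : ΩG D (w.side .W) (farW w)) (hr : RootedFace D (w.side .W) (farW w)) (h : ω.IsB2a)
    (hS : ω.2.firstSideG = .S) (θ : ℝ) :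
    ω.WE (fun _ => θ) = excursionWinding θ ω.2.firstSideG (ω.z1 hr h) ω.1 :=
  WE_eq_excursionWinding_of_under_ray_pairwise hh (fun _ x' hx hxx' => Or.inr (hray x' (by omega))) ω hr h hS θ

/-! ### The row-mirror twins: the top line of the root row, over-walks -/

/-- ★★★★★ **NO TWO LIVE COLUMNS ON THE TOP LINE ⇒ NO WOUND OVER-WALK** (row-mirror twin: hole absent; for all
`w.1 ≤ x < x'` one of `(x, w.2)`, `(x, w.2 + 1)`, `(x', w.2)`, `(x', w.2 + 1)` is absent; `ω` a class-`B2a` OVER-walk, first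
side `N`). [cite: GlazmanManolescu2019, §1 (Fig. 1, Fig. 2), §4.2 (lattice symmetries), Lemma 2.1]
[cite: Glazman2015WeightedSAW, Lemma 3.1 (proof, pp. 6–7)] [cite: CourantRobbins1958, Ch. V Appendix §2 (the even–odd rule)] -/
theorem WE_eq_excursionWinding_of_over_rayN_pairwise (hh : holeFaceW w ∉ D)
    (hray : ∀ x x' : ℤ, w.1 ≤ x → x < x' →
      ((x, w.2) ∉ D ∨ (x, w.2 + 1) ∉ D) ∨ ((x', w.2) ∉ D ∨ (x', w.2 + 1) ∉ D))
    (ω : ΩG D (w.side .W) (farW w)) (hr : RootedFace D (w.side .W) (farW w)) (h : ω.IsB2a)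
    (hN : ω.2.firstSideG = .N) (θ : ℝ) :
    ω.WE (fun _ => θ) = excursionWinding θ ω.2.firstSideG (ω.z1 hr h) ω.1 := by
  by_contra hW
  have hr' := rootedFace_rowMirrorDom w hr
  have h' := ω.mirrorFar_isB2a hr h
  have hh' : holeFaceW w ∉ rowMirrorDom w D := by rwa [mem_rowMirrorDom, mirrorRowFace_holeFaceW]
  have hray' : ∀ x x' : ℤ, w.1 ≤ x → x < x' →
      ((x, w.2) ∉ rowMirrorDom w D ∨ (x, w.2 - 1) ∉ rowMirrorDom w D) ∨
        ((x', w.2) ∉ rowMirrorDom w D ∨ (x', w.2 - 1) ∉ rowMirrorDom w D) := by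
    intro x x' hx hxx'
    rw [mem_rowMirrorDom, mem_rowMirrorDom, mem_rowMirrorDom, mem_rowMirrorDom, mirrorRowFace_row,
      mirrorRowFace_row_pred, mirrorRowFace_row, mirrorRowFace_row_pred]
    exact hray x x' hx hxx'
  have hS' : ω.mirrorFar.2.firstSideG = .S := by rw [mirrorFar_firstSideG, hN]; rfl
  exact absurd (WE_eq_excursionWinding_of_under_ray_pairwise hh' hray' ω.mirrorFar hr' h' hS' _)
    (ω.mirrorFar_wound hr h hW)

/-- ★★★★★ **THE TOP LINE SHUT EAST OF THE ROOT PLAQUETTE ⇒ NO WOUND OVER-WALK, WHATEVER `rootN`** (`(x, w.2) ∉ D ∨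
(x, w.2 + 1) ∉ D` for every `x ≥ w.1 + 1`; e.g. `rootE` or `pocketNE` absent with the wall beyond).
[cite: GlazmanManolescu2019, §1 (Fig. 1, Fig. 2), §4.2 (lattice symmetries), Lemma 2.1]
[cite: Glazman2015WeightedSAW, Lemma 3.1 (proof, pp. 6–7)] [cite: CourantRobbins1958, Ch. V Appendix §2 (the even–odd rule)] -/
theorem WE_eq_excursionWinding_of_over_eastShutN (hh : holeFaceW w ∉ D)
    (hray : ∀ x : ℤ, w.1 + 1 ≤ x → (x, w.2) ∉ D ∨ (x, w.2 + 1) ∉ D)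
    (ω : ΩG D (w.side .W) (farW w)) (hr : RootedFace D (w.side .W) (farW w)) (h : ω.IsB2a)
    (hN : ω.2.firstSideG = .N) (θ : ℝ) :
    ω.WE (fun _ => θ) = excursionWinding θ ω.2.firstSideG (ω.z1 hr h) ω.1 :=
  WE_eq_excursionWinding_of_over_rayN_pairwise hh (fun _ x' hx hxx' => Or.inr (hray x' (by omega))) ω hr h hN θ

/-- **The under-route mass vanishes when the ray is shut east of the root plaquette.**
[cite: GlazmanManolescu2019, Lemma 2.1, §2.1 (the weights)] [cite: Glazman2015WeightedSAW, Lemma 3.1 (proof, pp. 6–7)] -/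
theorem sum_routeMassW_S_eq_zero_of_eastShut [Finite D] (hh : holeFaceW w ∉ D)
    (hray : ∀ x : ℤ, w.1 + 1 ≤ x → (x, w.2) ∉ D ∨ (x, w.2 - 1) ∉ D)
    (hr : RootedFace D (w.side .W) (farW w)) (θ : ℝ) :
    ∑ ω ∈ setB2a D (w.side .W) (farW w), routeMassW θ hr .S ω = 0 :=
  sum_routeMassW_eq_zero_of_unwound hr .S θ fun ω h hS => WE_eq_excursionWinding_of_under_eastShut hh hray ω hr h hS θ

/-- **The over-route mass vanishes when the top line is shut east of the root plaquette.**
[cite: GlazmanManolescu2019, Lemma 2.1, §2.1 (the weights), §4.2] [cite: Glazman2015WeightedSAW, Lemma 3.1 (proof, pp. 6–7)] -/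
theorem sum_routeMassW_N_eq_zero_of_eastShutN [Finite D] (hh : holeFaceW w ∉ D)
    (hray : ∀ x : ℤ, w.1 + 1 ≤ x → (x, w.2) ∉ D ∨ (x, w.2 + 1) ∉ D)
    (hr : RootedFace D (w.side .W) (farW w)) (θ : ℝ) :
    ∑ ω ∈ setB2a D (w.side .W) (farW w), routeMassW θ hr .N ω = 0 :=
  sum_routeMassW_eq_zero_of_unwound hr .N θ fun ω h hN => WE_eq_excursionWinding_of_over_eastShutN hh hray ω hr h hN θ

end ΩG

end Literature.Probability.RandomPlanarGeometry.SAW.YangBaxter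

namespace Literature.Barriers.CriticalPhenomena.PlaquetteWalk

open Literature.Probability.RandomPlanarGeometry.SAW.YangBaxter
open Real Complex

/-! ## §2′ The vertex functional with the ray shut east of the root plaquette: `Im VF = v·M_N ≥ 0` -/

section EastShutVF

variable {Dl : List Face} {w : Face}

/-- ★★★★ **RAY SHUT EAST OF THE ROOT PLAQUETTE ⇒ `Im VF(θ) ≥ 0` ON THE WHOLE RANGE** (`VF = i·v·M_N`: the under route is
empty, the over route weighs non-negatively). With `PlaquetteWalkHoleRootEastWall` §4 (`VF(2π/3) = 0` when the eastern
pocket is absent with the wall beyond) the endpoint `2π/3` is an exact zero of this kind.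
[cite: GlazmanManolescu2019, Lemma 2.1 (statement, "in the form given in [Gl]"), §1 eq. (1)]
[cite: Glazman2015WeightedSAW, Lemma 3.1 (proof, pp. 6–7)] [cite: CourantRobbins1958, Ch. V Appendix §2 (the even–odd rule)] -/
theorem im_vertexFunctional_printed_nonneg_of_eastShut {θ : ℝ} (hθ : θ ∈ Set.Icc (π / 3) (2 * π / 3))
    (hf : farW w ∈ Dl) (hh : holeFaceW w ∉ dom Dl)
    (hray : ∀ x : ℤ, w.1 + 1 ≤ x → (x, w.2) ∉ dom Dl ∨ (x, w.2 - 1) ∉ dom Dl)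
    (hr : RootedFace (dom Dl) (w.side .W) (farW w)) :
    0 ≤ (vertexFunctional (printedWeights θ) tFiveEighths (ybCoeff θ) Dl (w.side .W) (farW w)).im := by
  rw [vertexFunctional_printed_farCellW_im_eq hθ Dl w hf hh hr, ΩG.sum_routeMassW_S_eq_zero_of_eastShut hh hray hr θ,
    sub_zero]
  exact mul_nonneg (weightV_pos_of_mem hθ).le (Finset.sum_nonneg fun ω _ => ΩG.routeMassW_nonneg hθ hr .N ω)

/-- ★★★★ **RAY SHUT EAST OF THE ROOT PLAQUETTE + ONE WOUND OVER-WALK ⇒ `Im VF(θ) > 0`** at every angle of the OPEN range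
(`VF = i·v·M_N` with `M_N(θ) > 0`). [cite: GlazmanManolescu2019, Lemma 2.1 (statement, "in the form given in [Gl]"), §1 eq. (1)]
[cite: Glazman2015WeightedSAW, Lemma 3.1 (proof, pp. 6–7)] [cite: CourantRobbins1958, Ch. V Appendix §2 (the even–odd rule)] -/
theorem im_vertexFunctional_printed_pos_of_eastShut_of_wound_over {θ : ℝ} (hθ : θ ∈ Set.Ioo (π / 3) (2 * π / 3))
    (hf : farW w ∈ Dl) (hh : holeFaceW w ∉ dom Dl)
    (hray : ∀ x : ℤ, w.1 + 1 ≤ x → (x, w.2) ∉ dom Dl ∨ (x, w.2 - 1) ∉ dom Dl)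
    (hr : RootedFace (dom Dl) (w.side .W) (farW w))
    (hO : ∃ (ω : ΩG (dom Dl) (w.side .W) (farW w)) (h : ω.IsB2a), ω.2.firstSideG = .N ∧
      ω.WE (fun _ => θ) ≠ excursionWinding θ ω.2.firstSideG (ω.z1 hr h) ω.1) :
    0 < (vertexFunctional (printedWeights θ) tFiveEighths (ybCoeff θ) Dl (w.side .W) (farW w)).im := by
  have hθ' : θ ∈ Set.Icc (π / 3) (2 * π / 3) := ⟨hθ.1.le, hθ.2.le⟩
  rw [vertexFunctional_printed_farCellW_im_eq hθ' Dl w hf hh hr, ΩG.sum_routeMassW_S_eq_zero_of_eastShut hh hray hr θ,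
    sub_zero]
  exact mul_pos (weightV_pos_of_mem hθ') (ΩG.sum_routeMassW_pos_of_wound hr .N hθ hO)

/-- ★★★★ **TOP LINE SHUT EAST OF THE ROOT PLAQUETTE ⇒ `Im VF(θ) ≤ 0` ON THE WHOLE RANGE** (`VF = −i·v·M_S`; row-mirror twin).
[cite: GlazmanManolescu2019, Lemma 2.1 (statement, "in the form given in [Gl]"), §1 eq. (1), §4.2]
[cite: Glazman2015WeightedSAW, Lemma 3.1 (proof, pp. 6–7)] [cite: CourantRobbins1958, Ch. V Appendix §2 (the even–odd rule)] -/
theorem im_vertexFunctional_printed_nonpos_of_eastShutN {θ : ℝ} (hθ : θ ∈ Set.Icc (π / 3) (2 * π / 3))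
    (hf : farW w ∈ Dl) (hh : holeFaceW w ∉ dom Dl)
    (hray : ∀ x : ℤ, w.1 + 1 ≤ x → (x, w.2) ∉ dom Dl ∨ (x, w.2 + 1) ∉ dom Dl)
    (hr : RootedFace (dom Dl) (w.side .W) (farW w)) :
    (vertexFunctional (printedWeights θ) tFiveEighths (ybCoeff θ) Dl (w.side .W) (farW w)).im ≤ 0 := by
  rw [vertexFunctional_printed_farCellW_im_eq hθ Dl w hf hh hr, ΩG.sum_routeMassW_N_eq_zero_of_eastShutN hh hray hr θ,
    zero_sub, mul_neg, neg_nonpos]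
  exact mul_nonneg (weightV_pos_of_mem hθ).le (Finset.sum_nonneg fun ω _ => ΩG.routeMassW_nonneg hθ hr .S ω)

/-- ★★★ **BOTH LINES OF THE ROOT ROW SHUT EAST OF THE ROOT PLAQUETTE ⇒ `VF ≡ 0`** on `[π/3, 2π/3]` (e.g. `rootE` absent with
the wall beyond — `PlaquetteWalkHoleRootEastWall` §3 by another route — or both eastern pockets absent with the wall beyond:
NEW). [cite: GlazmanManolescu2019, Lemma 2.1 (statement, "in the form given in [Gl]")] [cite: Glazman2015WeightedSAW, Lemma 3.1 (proof, pp. 6–7)] -/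
theorem vertexFunctional_printed_eq_zero_of_eastShut_both {θ : ℝ} (hθ : θ ∈ Set.Icc (π / 3) (2 * π / 3))
    (hf : farW w ∈ Dl) (hh : holeFaceW w ∉ dom Dl)
    (hrayS : ∀ x : ℤ, w.1 + 1 ≤ x → (x, w.2) ∉ dom Dl ∨ (x, w.2 - 1) ∉ dom Dl)
    (hrayN : ∀ x : ℤ, w.1 + 1 ≤ x → (x, w.2) ∉ dom Dl ∨ (x, w.2 + 1) ∉ dom Dl) :
    vertexFunctional (printedWeights θ) tFiveEighths (ybCoeff θ) Dl (w.side .W) (farW w) = 0 := by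
  have hr : RootedFace (dom Dl) (w.side .W) (farW w) := ⟨hf, fun hb => hh (by rw [root_faces_W] at hb; exact hb.1)⟩
  rw [vertexFunctional_printed_farCellW_eq hθ Dl w hf hh hr, ΩG.sum_routeMassW_S_eq_zero_of_eastShut hh hrayS hr θ,
    ΩG.sum_routeMassW_N_eq_zero_of_eastShutN hh hrayN hr θ]
  simp

end EastShutVF

/-! ## §3 Boxes: the eastern pocket on the east wall empties its route -/

section Boxes

variable {m n : ℕ} {S : List Face} {h : Face}

/-- ★★★★★ **ALL BOXES: THE HOLE TWO COLUMNS FROM THE EAST WALL (`h.1 + 3 = m`) AND THE EASTERN POCKET `(h.1 + 2, h.2 − 1)`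
REMOVED ⇒ NO WOUND UNDER-WALK**, whatever else `S ∋ h` removes (far cell kept): the ray column `h.1 + 2` dies with the pocket
and the columns beyond are outside the box, so only the root plaquette's own column could be crossed — never by an
under-excursion. (The lane's LAW L table, `PlaquetteWalkHoleRootEastWall` §5: this cell was a `w₁`-kill, `VF(2π/3) = 0`.)
[cite: GlazmanManolescu2019, Lemma 2.1 (statement, "in the form given in [Gl]"), §2.1]
[cite: Glazman2015WeightedSAW, Lemma 3.1 (proof, pp. 6–7)] [cite: CourantRobbins1958, Ch. V Appendix §2 (the even–odd rule)] -/
theorem lawL_box_eastPocketSE_not_wound_under (hW : 1 ≤ h.1) (hE3 : h.1 + 3 = m) (hS0 : 0 ≤ h.2) (hN : h.2 + 1 ≤ n)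
    (hh : h ∈ S) (hfS : ((h.1 - 1, h.2) : Face) ∉ S) (hcP : ((h.1 + 2, h.2 - 1) : Face) ∈ S)
    (ω : ΩG (dom (boxMinus m n S)) (Face.side (h.1 + 1, h.2) .W) (farW (h.1 + 1, h.2))) (hb : ω.IsB2a)
    (hS' : ω.2.firstSideG = .S) (θ : ℝ) :
    ω.WE (fun _ => θ) = excursionWinding θ ω.2.firstSideG
      (ω.z1 (rootedFace_hroot_boxMinus_of_mem (farW_hroot_mem_boxMinus_of_not_mem hW (by omega) hS0 hN hfS) hh) hb)
      ω.1 := by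
  refine ΩG.WE_eq_excursionWinding_of_under_eastShut ?_ (fun x hx => ?_) ω _ hb hS' θ
  · rw [holeFaceW_hroot]; exact not_mem_dom_boxMinus_of_mem hh
  · simp only at hx ⊢
    rcases eq_or_lt_of_le hx with hl | hg
    · have ex : x = h.1 + 2 := by omega
      subst ex; exact Or.inr (not_mem_dom_boxMinus_of_mem hcP)
    · left
      intro hm
      obtain ⟨hb', -⟩ := mem_dom_boxMinus.1 hm
      simp only at hb'
      omega

/-- ★★★★★ **TWIN: `h.1 + 3 = m` and the north-eastern pocket `(h.1 + 2, h.2 + 1)` removed ⇒ NO WOUND OVER-WALK.**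
[cite: GlazmanManolescu2019, Lemma 2.1 (statement, "in the form given in [Gl]"), §2.1, §4.2]
[cite: Glazman2015WeightedSAW, Lemma 3.1 (proof, pp. 6–7)] [cite: CourantRobbins1958, Ch. V Appendix §2 (the even–odd rule)] -/
theorem lawL_box_eastPocketNE_not_wound_over (hW : 1 ≤ h.1) (hE3 : h.1 + 3 = m) (hS0 : 0 ≤ h.2) (hN : h.2 + 1 ≤ n)
    (hh : h ∈ S) (hfS : ((h.1 - 1, h.2) : Face) ∉ S) (hcP : ((h.1 + 2, h.2 + 1) : Face) ∈ S)
    (ω : ΩG (dom (boxMinus m n S)) (Face.side (h.1 + 1, h.2) .W) (farW (h.1 + 1, h.2))) (hb : ω.IsB2a)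
    (hN' : ω.2.firstSideG = .N) (θ : ℝ) :
    ω.WE (fun _ => θ) = excursionWinding θ ω.2.firstSideG
      (ω.z1 (rootedFace_hroot_boxMinus_of_mem (farW_hroot_mem_boxMinus_of_not_mem hW (by omega) hS0 hN hfS) hh) hb)
      ω.1 := by
  refine ΩG.WE_eq_excursionWinding_of_over_eastShutN ?_ (fun x hx => ?_) ω _ hb hN' θ
  · rw [holeFaceW_hroot]; exact not_mem_dom_boxMinus_of_mem hh
  · simp only at hx ⊢
    rcases eq_or_lt_of_le hx with hl | hg
    · have ex : x = h.1 + 2 := by omega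
      subst ex; exact Or.inr (not_mem_dom_boxMinus_of_mem hcP)
    · left
      intro hm
      obtain ⟨hb', -⟩ := mem_dom_boxMinus.1 hm
      simp only at hb'
      omega

/-- ★★★★ **The under-route mass VANISHES in every such box** (`h.1 + 3 = m`, eastern pocket removed), at every angle.
[cite: GlazmanManolescu2019, Lemma 2.1, §2.1 (the weights)] [cite: Glazman2015WeightedSAW, Lemma 3.1 (proof, pp. 6–7)] -/
theorem lawL_box_eastPocketSE_sum_routeMassW_S_eq_zero (hW : 1 ≤ h.1) (hE3 : h.1 + 3 = m) (hS0 : 0 ≤ h.2)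
    (hN : h.2 + 1 ≤ n) (hh : h ∈ S) (hfS : ((h.1 - 1, h.2) : Face) ∉ S) (hcP : ((h.1 + 2, h.2 - 1) : Face) ∈ S) (θ : ℝ) :
    ∑ ω ∈ ΩG.setB2a (dom (boxMinus m n S)) (Face.side (h.1 + 1, h.2) .W) (farW (h.1 + 1, h.2)),
      ΩG.routeMassW θ (rootedFace_hroot_boxMinus_of_mem (farW_hroot_mem_boxMinus_of_not_mem hW (by omega) hS0 hN hfS) hh)
        .S ω = 0 :=
  ΩG.sum_routeMassW_eq_zero_of_unwound _ .S θ fun ω hb hS' =>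
    lawL_box_eastPocketSE_not_wound_under hW hE3 hS0 hN hh hfS hcP ω hb hS' θ

end Boxes

end Literature.Barriers.CriticalPhenomena.PlaquetteWalk
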